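import Summits.QuantumFields.BalabanUV.Beta.EriceFlowEnclosureB12AsPrintedPointwiseFadingZeroHistoryConstantsStability

/-!
# Beta / EriceFlowEnclosureB12AsPrintedPointwiseFadingZeroHistoryConstantsWitness — WHAT (0.31) FORCES, part 14d: THE TILTED RAMP.
# ON THE FACE, `(b⁰, b⋆)` DO NOT DECIDE THEOREM 2 AS TYPED, AND THE TYPED READING IS NOT AN OPEN CONDITION.
# Part 8a's ramp family (β_1 ≡ 1, β_2(g₀, g₁) = g₁(2g₁ − g₀), β_{k+1} ≡ 1 for k ≥ 2) carries node U2's letters and [I] Theorem 2 AS TYPED (`theorem2_typed_ramp`), with zero-history values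
# `b⁰ = (1, 0, 1, 1, …)` (part 14b `zeroHist_ramp`) — it sits on the face `b⁰_1 = 0`.  TILT IT: **β^ε_2(g₀, g₁) := g₁(2g₁ − g₀ − ε)**, ε > 0, the other scales unchanged.  Then (this file,
# for EVERY setting `S` whose `S.β` is the tilted family):
#  §1 the tilted family is `εδ`-CLOSE to the ramp on every box ]0, δ]^{k+1} (`abs_ramp_sub_tilted_le`) and carries ALL the letters: (U) `BetaUpperH 1 (1∕2)`, (C), node U2's moduli
#     `HistLipschitz` (Λ 1 i = 5γ + ε) with `FadingMemory ((5γ+ε)∕θ) θ`, NE4 `ScaleShiftRate (2∕θ) θ γ` (γ ≤ ½, 0 < θ ≤ 1, ε ≤ 1), and `hrg` from the printed `Definitions`;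
#  §2 it has THE SAME zero-history values `b⁰ = (1, 0, 1, 1, …)` (`zeroHist_tilted`: β^ε_2(u, u) = u² − εu → 0) — all `≥ 0` — and THE SAME asymptotic constant `b⋆ = 1 > 0`
#     (`betaInf_tilted`, `hb_tilted`): part 14b §4's NECESSARY condition `0 < b⋆ ∧ ∀k, 0 ≤ b⁰_k` holds;
#  §3 and yet **THEOREM 2 AS TYPED FAILS** (`not_theorem2_tilted`): on the lattice K = 2 at any endpoint `g < ε∕2` every run of (0.20) in the box has `g₁ ≤ g`, so its last window is
#     `β^ε_2(g₀, g₁) = g₁(2g₁ − g₀ − ε) < 0`, while (0.31) asks `≥ β(g) ln L > 0`.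
# HENCE (`face_undecided_by_zeroHist`, `typedTheorem2_not_open`): two families with node U2's letters, IDENTICAL zero-history values and asymptotic constant — one carrying Theorem 2 as typed
# (part 8a), one refuting it for every setting — so on the face the history term decides (part 14b §4 is sharp); and since the tilt is arbitrarily small, the TYPED reading of (0.31) is NOT
# an open condition in the sup-norm on boxes, in contrast with the g-UNIFORM reading (part 14c `uniformTheorem2_isOpen`, margin `⨅ b⁰` — which is 0 here).
# (β-flow team, prover 2 = lower ∕ positivity side, unit `b2b-balaban-beta-bflow-p2`, gen 52; witness part of part 14)

HONEST FRAMING (page 1 of everything the β sub-cell writes): discharging `BetaPertH` makes Bałaban's UV stability UNCONDITIONAL — a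
real constructive-QFT result; it is NOT the continuum limit and NOT the Clay problem.  HONEST DEPENDENCY (cell reorg 2026-08-19,
verbatim): «continuum YM on T⁴ ⇐ BetaPertH ∧ nine spine estimates (0/9 proved); BetaPertH ⇐ (D1) ∧ (D4) ∧ CAP+tail; G-an2-4 gates
asym, D1 and NE2/3/4.»  THIS MODULE DISCHARGES NOTHING: a TOY two-coupling family (NOT Bałaban's (1.22)), displayed as a hypothesis `hβ` on an abstract `Setting S` exactly as part 8a's
ramp; [folklore] algebra + the unpacking of `Theorem2Statement` (STATED WITHOUT PROOF in print, p. 259 — here REFUTED for the toy, under prover 1's binder `hrg` or the printed `Definitions`);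
node U2's HYPOTHESIS SHAPES verified for the toy; part 14's `lastWindow_of_runH` ∕ `le_end_of_discrete031H`, part 1's `tunedRuns_of_theorem2Statement`, `hrg_of_betaUpperH` BY NAME.  A
def-free SETTING carrying the tilted family together with [I]'s typed `Definitions` is NOT built here (part 8b's construction for the ramp would serve verbatim); every statement is «for every
setting S with S.β = the tilted family».  Nothing is asserted about Bałaban's β-functions.

WHAT THIS FILE PROVES (0 sorry, 0 def):
§1 `beta_one`, `abs_beta_le_one`, **`abs_ramp_sub_tilted_le`**, `betaUpperH_tilted`, `betaContH_tilted`, `histLipschitz_tilted`, `fadingMemory_tilted`, `scaleShiftRate_tilted`,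
   `hrg_tilted`.
§2 **`zeroHist_tilted`**, `betaInf_tilted`, `hb_tilted`.
§3 **`not_theorem2_tilted`**, `not_theorem2_tilted'`, **`face_undecided_by_zeroHist`**, **`typedTheorem2_not_open`**.
NOT CLAIMED: anything about Bałaban's β; which reading print intends; Theorem 2; `BetaPertH`; continuum; Clay.
-/

namespace Summit.QuantumFields.BalabanUV.Beta.EriceFlowEnclosureB12AsPrintedPointwiseFadingZeroHistoryConstantsWitness

open Finset Filter Topology
open Literature.MathematicalPhysics.QuantumFieldTheory.Balaban1983to89
open Literature.MathematicalPhysics.QuantumFieldTheory.Balaban1983to89.B12BetaAsPrinted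
open Literature.MathematicalPhysics.QuantumFieldTheory.Balaban1983to89.FlowStep (HBeta prefixOf Box mem_box box_mono RGEqH BetaLowerH BetaUpperH
  BetaAFH BetaContH)
open Literature.MathematicalPhysics.QuantumFieldTheory.Balaban1983to89.T4CouplingMatching (HistLipschitz FadingMemory ScaleShiftRate)
open Literature.MathematicalPhysics.QuantumFieldTheory.Balaban1983to89.T4BetaStationary (betaInf revHist)
open Summit.QuantumFields.BalabanUV.Beta.EriceFlowEnclosureB12AsPrintedUpper (tunedRuns_of_theorem2Statement)
open Summit.QuantumFields.BalabanUV.Beta.EriceFlowEnclosureB12AsPrintedTunedUpper (hrg_of_betaUpperH prefixOf_mem_box_of_inInterval)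
open Summit.QuantumFields.BalabanUV.Beta.EriceFlowEnclosureB12AsPrintedPointwiseFadingZeroHistoryConstants

noncomputable section

section Family

variable {S : Setting} {ε : ℝ}
  (hβ : ∀ (k : ℕ) (p : Fin (k + 1) → ℝ), S.β k p = if k = 1 then p (Fin.last k) * (2 * p (Fin.last k) - p 0 - ε) else 1)
include hβ

/-! ## §1 The tilted ramp: values, closeness to the ramp, and ALL the letters -/

/-- At scale 1: β^ε_2(g₀, g₁) = g₁·(2g₁ − g₀ − ε). [folklore] -/
theorem beta_one (p : Fin (1 + 1) → ℝ) : S.β 1 p = p 1 * (2 * p 1 - p 0 - ε) := by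
  rw [hβ, if_pos rfl]; rfl

/-- |β^ε_{k+1}| ≤ 1 on every box ]0, γ]^{k+1} with γ ≤ ½ (0 ≤ ε ≤ 1). [folklore] -/
theorem abs_beta_le_one (hε0 : 0 ≤ ε) (hε1 : ε ≤ 1) {γ : ℝ} (hγ : γ ≤ 1 / 2) (k : ℕ) {p : Fin (k + 1) → ℝ} (hp : p ∈ Box γ k) :
    |S.β k p| ≤ 1 := by
  by_cases hk : k = 1
  · subst hk
    have h0 := (mem_box.mp hp) 0
    have h1 := (mem_box.mp hp) 1
    rw [beta_one hβ, abs_mul, abs_of_pos h1.1]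
    have hA : |2 * p 1 - p 0 - ε| ≤ 3 / 2 := abs_le.mpr ⟨by linarith, by linarith⟩
    nlinarith [abs_nonneg (2 * p 1 - p 0 - ε), h1.1]
  · rw [hβ, if_neg hk]; simp

/-- **THE TILT IS SMALL**: against part 8a's ramp `βr` (β_2 = g₁(2g₁ − g₀)), `|βr_{k+1}(v) − β^ε_{k+1}(v)| ≤ ε·δ` on every box ]0, δ]^{k+1} (0 ≤ ε): the two families are `εδ`-close near zero,
for EVERY ε. [folklore] -/
theorem abs_ramp_sub_tilted_le (hε0 : 0 ≤ ε) {βr : HBeta}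
    (hβr : ∀ (k : ℕ) (p : Fin (k + 1) → ℝ), βr k p = if k = 1 then p (Fin.last k) * (2 * p (Fin.last k) - p 0) else 1)
    {δ : ℝ} (k : ℕ) {v : Fin (k + 1) → ℝ} (hv : v ∈ Box δ k) : |βr k v - S.β k v| ≤ ε * δ := by
  by_cases hk : k = 1
  · subst hk
    have h1 := (mem_box.mp hv) (Fin.last 1)
    rw [hβr, hβ, if_pos rfl, if_pos rfl]
    have e : v (Fin.last 1) * (2 * v (Fin.last 1) - v 0) - v (Fin.last 1) * (2 * v (Fin.last 1) - v 0 - ε) = ε * v (Fin.last 1) := by ring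
    rw [e, abs_of_nonneg (mul_nonneg hε0 h1.1.le)]
    exact mul_le_mul_of_nonneg_left h1.2 hε0
  · rw [hβr, hβ, if_neg hk, if_neg hk, sub_self, abs_zero]
    have h0 := (mem_box.mp hv) 0
    nlinarith [h0.1, h0.2]

/-- (U): `BetaUpperH 1 (1∕2)` (0 ≤ ε ≤ 1). [folklore] -/
theorem betaUpperH_tilted (hε0 : 0 ≤ ε) (hε1 : ε ≤ 1) : BetaUpperH 1 (1 / 2) S.β := fun k _ hp =>
  (le_abs_self _).trans (abs_beta_le_one hβ hε0 hε1 le_rfl k hp)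

/-- (C): every β^ε_{k+1} is continuous (a polynomial), on every box. [folklore] -/
theorem betaContH_tilted (γ : ℝ) : BetaContH γ S.β := by
  intro k
  by_cases hk : k = 1
  · have e : S.β k = fun p : Fin (k + 1) → ℝ => p (Fin.last k) * (2 * p (Fin.last k) - p 0 - ε) :=
      funext fun _ => by rw [hβ, if_pos hk]
    rw [e]
    exact Continuous.continuousOn (by fun_prop)
  · have e : S.β k = fun _ : Fin (k + 1) → ℝ => (1 : ℝ) := funext fun _ => by rw [hβ, if_neg hk]
    rw [e]
    exact continuousOn_const

/-- node U2's COUPLING-CHART MODULI: `HistLipschitz Λ γ S.β` with Λ 1 i = 5γ + ε, Λ k i = 0 (k ≠ 1), on every box ]0, γ]^{k+1} (γ ≥ 0, ε ≥ 0):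
β^ε_2(p) − β^ε_2(q) = (2(p₁ + q₁) − p₀)(p₁ − q₁) − q₁(p₀ − q₀) − ε(p₁ − q₁). [folklore] -/
theorem histLipschitz_tilted (hε0 : 0 ≤ ε) {γ : ℝ} (hγ : 0 ≤ γ) : HistLipschitz (fun k _ => if k = 1 then 5 * γ + ε else 0) γ S.β := by
  intro k p q hp hq
  by_cases hk : k = 1
  · subst hk
    simp only [if_true]
    rw [beta_one hβ, beta_one hβ, Fin.sum_univ_two]
    have hp0 := (mem_box.mp hp) 0
    have hp1 := (mem_box.mp hp) 1
    have hq0 := (mem_box.mp hq) 0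
    have hq1 := (mem_box.mp hq) 1
    have key : p 1 * (2 * p 1 - p 0 - ε) - q 1 * (2 * q 1 - q 0 - ε)
        = (2 * (p 1 + q 1) - p 0 - ε) * (p 1 - q 1) - q 1 * (p 0 - q 0) := by ring
    rw [key]
    have hA : |2 * (p 1 + q 1) - p 0 - ε| ≤ 4 * γ + ε := abs_le.mpr ⟨by linarith, by linarith⟩
    have hB : |q 1| ≤ γ := abs_le.mpr ⟨by linarith, hq1.2⟩
    calc |(2 * (p 1 + q 1) - p 0 - ε) * (p 1 - q 1) - q 1 * (p 0 - q 0)|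
        ≤ |(2 * (p 1 + q 1) - p 0 - ε) * (p 1 - q 1)| + |q 1 * (p 0 - q 0)| := abs_sub _ _
      _ = |2 * (p 1 + q 1) - p 0 - ε| * |p 1 - q 1| + |q 1| * |p 0 - q 0| := by rw [abs_mul, abs_mul]
      _ ≤ (4 * γ + ε) * |p 1 - q 1| + γ * |p 0 - q 0| :=
          add_le_add (mul_le_mul_of_nonneg_right hA (abs_nonneg _)) (mul_le_mul_of_nonneg_right hB (abs_nonneg _))
      _ ≤ (5 * γ + ε) * |((p : Fin (1 + 1) → ℝ)) 0 - q 0| + (5 * γ + ε) * |p 1 - q 1| := by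
          nlinarith [abs_nonneg (p 0 - q 0), abs_nonneg (p 1 - q 1)]
  · rw [hβ k p, hβ k q, if_neg hk, if_neg hk, sub_self, abs_zero]
    exact Finset.sum_nonneg fun i _ => mul_nonneg (by simp [hk]) (abs_nonneg _)

omit hβ in
/-- … with FADING MEMORY at every rate 0 < θ ≤ 1: `FadingMemory ((5γ+ε)∕θ) θ Λ`. [folklore] -/
theorem fadingMemory_tilted (hε0 : 0 ≤ ε) {γ θ : ℝ} (hγ : 0 ≤ γ) (hθ0 : 0 < θ) (hθ1 : θ ≤ 1) :
    FadingMemory ((5 * γ + ε) / θ) θ (fun k _ => if k = 1 then 5 * γ + ε else 0) := by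
  intro k i hik
  have hC : 0 ≤ (5 * γ + ε) / θ := by positivity
  by_cases hk : k = 1
  · subst hk
    simp only [if_true]
    refine ⟨by positivity, ?_⟩
    interval_cases i
    · rw [Nat.sub_zero, pow_one, div_mul_cancel₀ _ hθ0.ne']
    · rw [Nat.sub_self, pow_zero, mul_one, le_div_iff₀ hθ0]; nlinarith
  · simp only [hk, if_false]
    exact ⟨le_rfl, by positivity⟩

/-- NE4: `ScaleShiftRate (2∕θ) θ γ S.β` for γ ≤ ½, 0 < θ ≤ 1, 0 ≤ ε ≤ 1 (the scales k ≥ 2 agree exactly; at k = 0, 1 both values are ≤ 1 in modulus). [folklore] -/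
theorem scaleShiftRate_tilted (hε0 : 0 ≤ ε) (hε1 : ε ≤ 1) {γ θ : ℝ} (hγ : γ ≤ 1 / 2) (hθ0 : 0 < θ) (hθ1 : θ ≤ 1) :
    ScaleShiftRate (2 / θ) θ γ S.β := by
  intro k w hw
  have htail : Fin.tail w ∈ Box γ k := mem_box.mpr fun i => (mem_box.mp hw) i.succ
  by_cases hk : 2 ≤ k
  · have h1 : k + 1 ≠ 1 := by omega
    have h2 : k ≠ 1 := by omega
    rw [hβ (k + 1) w, hβ k (Fin.tail w), if_neg h1, if_neg h2, sub_self, abs_zero]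
    positivity
  · have hA := abs_beta_le_one hβ hε0 hε1 hγ (k + 1) hw
    have hB := abs_beta_le_one hβ hε0 hε1 hγ k htail
    have hθk : θ ≤ θ ^ k := by
      interval_cases k
      · rw [pow_zero]; exact hθ1
      · rw [pow_one]
    calc |S.β (k + 1) w - S.β k (Fin.tail w)| ≤ |S.β (k + 1) w| + |S.β k (Fin.tail w)| := abs_sub _ _
      _ ≤ 2 := by linarith
      _ = 2 / θ * θ := by field_simp
      _ ≤ 2 / θ * θ ^ k := mul_le_mul_of_nonneg_left hθk (by positivity)

/-- Prover 1's binder `hrg` on ]0, ½] from the printed `Definitions` and (U) (`hrg_of_betaUpperH`, 1·(½)² < 1). [cite: Balaban1987RG1, (0.20) p.256] -/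
theorem hrg_tilted (hε0 : 0 ≤ ε) (hε1 : ε ≤ 1) (hD : Definitions S) :
    ∀ P : B12.RunParams, Step.InInterval (1 / 2) P.K (S.cpl P) → RGEqH P.K S.β (S.cpl P) :=
  hrg_of_betaUpperH hD (by norm_num) (betaUpperH_tilted hβ hε0 hε1) (by norm_num)

/-! ## §2 The same zero-history values as the ramp, the same asymptotic constant -/

/-- **SAME ZERO-HISTORY VALUES AS THE RAMP: `b⁰ = (1, 0, 1, 1, …)`.**  For `θ < 1`, `0 < γ`, `0 ≤ ε` and any constant with `(γ + ε)(1−θ) ≤ C` (the §1 constant `(5γ+ε)∕θ` qualifies for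
θ ≤ 1) the displayed property `hb0` of part 13 holds with `b⁰_1 = 0` (β^ε_2(u, u) = u² − εu, |u² − εu| ≤ u(γ + ε)) and `b⁰_k = 1` otherwise — all entries `≥ 0`. [folklore] -/
theorem zeroHist_tilted (hε0 : 0 ≤ ε) {γ C θ : ℝ} (hθ1 : θ < 1) (hγ : 0 < γ) (hCγ : (γ + ε) * (1 - θ) ≤ C) (k : ℕ) (u : ℝ) (hu : 0 < u) (huγ : u ≤ γ) :
    |S.β k (fun _ : Fin (k + 1) => u) - (if k = 1 then (0 : ℝ) else 1)| ≤ C * u / (1 - θ) := by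
  have h1θ : 0 < 1 - θ := by linarith
  have hC : 0 ≤ C := le_trans (by positivity) hCγ
  by_cases hk : k = 1
  · subst hk
    rw [if_pos rfl, beta_one hβ, sub_zero, le_div_iff₀ h1θ]
    have e : u * (2 * u - u - ε) = u * (u - ε) := by ring
    rw [e, abs_mul, abs_of_pos hu]
    have hA : |u - ε| ≤ γ + ε := abs_le.mpr ⟨by linarith, by linarith⟩
    calc u * |u - ε| * (1 - θ) = u * (|u - ε| * (1 - θ)) := by ring
      _ ≤ u * ((γ + ε) * (1 - θ)) := mul_le_mul_of_nonneg_left (mul_le_mul_of_nonneg_right hA h1θ.le) hu.le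
      _ ≤ u * C := mul_le_mul_of_nonneg_left hCγ hu.le
      _ = C * u := mul_comm _ _
  · rw [if_neg hk, hβ, if_neg hk, sub_self, abs_zero]
    positivity

/-- The stationary functional of the tilted family is the constant 1 at EVERY history (the β-values on the prefixes are 1 from scale 2 on). [folklore] -/
theorem betaInf_tilted (h : ℕ → ℝ) : betaInf S.β h = 1 := by
  have hev : (fun _ : ℕ => (1 : ℝ)) =ᶠ[atTop] fun k => S.β k (revHist h k) :=
    Filter.eventually_atTop.2 ⟨2, fun k hk => by show (1 : ℝ) = S.β k (revHist h k); rw [hβ, if_neg (by omega : k ≠ 1)]⟩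
  exact (tendsto_const_nhds.congr' hev).limUnder_eq

/-- **SAME ASYMPTOTIC CONSTANT AS THE RAMP: `b⋆ = 1 > 0`** — part 11's displayed property `hb` with `b⋆ = 1`, for any `C ≥ 0`, `θ < 1`. [folklore] -/
theorem hb_tilted {γ C θ : ℝ} (hC : 0 ≤ C) (hθ1 : θ < 1) (u : ℝ) (hu : 0 < u) (_huγ : u ≤ γ) :
    |betaInf S.β (fun _ : ℕ => u) - 1| ≤ C * u / (1 - θ) := by
  rw [betaInf_tilted hβ, sub_self, abs_zero]
  have h1θ : 0 < 1 - θ := by linarith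
  positivity

/-! ## §3 Theorem 2 as typed FAILS for the tilted family; the face is undecided by (b⁰, b⋆); the typed reading is not open -/

/-- **THEOREM 2 AS TYPED FAILS FOR THE TILTED RAMP** (ε > 0), for EVERY setting whose β is the tilted family and which carries prover 1's binder `hrg` on ]0, ½]: Theorem 2's run on the
lattice K = 2 at an endpoint `g ≤ ε∕4` (inside the box `min(γ₀, ½)`) has `g₁ ≤ g` (the lower (0.31) at k = 1 with a positive constant), hence its last window
`1∕g₁² − 1∕g² = β^ε_2(g₀, g₁) = g₁(2g₁ − g₀ − ε) < 0` — while (0.31) at k = 1 demands `≥ β(g) ln L > 0`. [cite: Balaban1987RG1, Thm 2 (0.31) p.259 with (0.20) p.256] -/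
theorem not_theorem2_tilted (hε : 0 < ε) {hL : Odd S.L ∧ 1 < S.L}
    (hrg : ∀ P : B12.RunParams, Step.InInterval (1 / 2) P.K (S.cpl P) → RGEqH P.K S.β (S.cpl P)) : ¬ Theorem2Statement S hL := by
  intro hT
  have hlog : 0 < Real.log (S.L : ℝ) := Real.log_pos (by exact_mod_cast hL.2)
  obtain ⟨γ₀, hγ₀, hγ⟩ := tunedRuns_of_theorem2Statement hT 0
  obtain ⟨g₁, hg₁, hg⟩ := hγ (min γ₀ (1 / 2)) (lt_min hγ₀ (by norm_num)) (min_le_left _ _)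
  obtain ⟨β, β', hβpos, -, hK⟩ := hg (min g₁ (ε / 4)) (lt_min hg₁ (by positivity)) (min_le_left _ _)
  obtain ⟨g₀, hI, hend, hD⟩ := hK 2
  have hIU : Step.InInterval (1 / 2) 2 (S.cpl ⟨2, 0, g₀⟩) := fun i hi => ⟨(hI i hi).1, (hI i hi).2.trans (min_le_right _ _)⟩
  have hrgr : RGEqH 2 S.β (S.cpl ⟨2, 0, g₀⟩) := hrg ⟨2, 0, g₀⟩ hIU
  rw [← hend] at hD
  obtain ⟨hlo, -⟩ := lastWindow_of_runH (β := S.β) (k := 1) hrgr hD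
  have hr1 : S.cpl ⟨2, 0, g₀⟩ 1 ≤ ε / 4 := by
    have h := le_end_of_discrete031H (mul_pos hβpos hlog).le (fun i hi => (hI i hi).1) hD (i := 1) (by norm_num)
    rw [hend] at h
    exact h.trans (min_le_right _ _)
  have hr0 : 0 < S.cpl ⟨2, 0, g₀⟩ 0 := (hI 0 (by norm_num)).1
  have hr1pos : 0 < S.cpl ⟨2, 0, g₀⟩ 1 := (hI 1 (by norm_num)).1
  have e0 : prefixOf (S.cpl ⟨2, 0, g₀⟩) 1 0 = S.cpl ⟨2, 0, g₀⟩ 0 := rfl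
  have e1 : prefixOf (S.cpl ⟨2, 0, g₀⟩) 1 1 = S.cpl ⟨2, 0, g₀⟩ 1 := rfl
  rw [beta_one hβ, e0, e1] at hlo
  have hneg : S.cpl ⟨2, 0, g₀⟩ 1 * (2 * S.cpl ⟨2, 0, g₀⟩ 1 - S.cpl ⟨2, 0, g₀⟩ 0 - ε) < 0 :=
    mul_neg_of_pos_of_neg hr1pos (by linarith)
  linarith [mul_pos hβpos hlog]

/-- The same with `hrg` DISCHARGED from the printed `Definitions` (§1's (U) on ]0, ½]). [cite: Balaban1987RG1, Thm 2 (0.31) p.259 with (0.20) p.256] -/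
theorem not_theorem2_tilted' (hε : 0 < ε) (hε1 : ε ≤ 1) (hD : Definitions S) {hL : Odd S.L ∧ 1 < S.L} : ¬ Theorem2Statement S hL :=
  not_theorem2_tilted hβ hε (hrg_tilted hβ hε.le hε1 hD)

/-- **ON THE FACE, `(b⁰, b⋆)` DO NOT DECIDE THEOREM 2 AS TYPED.**  The tilted ramp (0 < ε ≤ 1) carries node U2's letters on ]0, γ] (γ ≤ ½, 0 < θ < 1: moduli with
`FadingMemory ((5γ+ε)∕θ) θ`, NE4 `ScaleShiftRate (2∕θ) θ γ`), the zero-history values `b⁰ = (1, 0, 1, 1, …)` (all `≥ 0`, one `= 0`) and `b⋆ = 1 > 0` — EXACTLY the data of part 8a's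
ramp, which carries Theorem 2 as typed (`theorem2_typed_ramp`) — and Theorem 2 as typed FAILS for it under `hrg`.  Part 14b's necessary condition `0 < b⋆ ∧ ∀k, 0 ≤ b⁰_k` is therefore
NOT sufficient, and its sufficient condition `∀k, 0 < b⁰_k` not necessary (the ramp): on the face the HISTORY TERM decides, as at the `b⋆ = 0` boundary of part 13b. [folklore] -/
theorem face_undecided_by_zeroHist (hε : 0 < ε) (hε1 : ε ≤ 1) {γ θ : ℝ} (hγ0 : 0 < γ) (hγ : γ ≤ 1 / 2) (hθ0 : 0 < θ) (hθ1 : θ < 1)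
    {hL : Odd S.L ∧ 1 < S.L} (hrg : ∀ P : B12.RunParams, Step.InInterval (1 / 2) P.K (S.cpl P) → RGEqH P.K S.β (S.cpl P)) :
    HistLipschitz (fun k _ => if k = 1 then 5 * γ + ε else 0) γ S.β ∧
      FadingMemory ((5 * γ + ε) / θ) θ (fun k _ => if k = 1 then 5 * γ + ε else 0) ∧ ScaleShiftRate (2 / θ) θ γ S.β ∧
      (∀ (k : ℕ) (u : ℝ), 0 < u → u ≤ γ → |S.β k (fun _ : Fin (k + 1) => u) - (if k = 1 then (0 : ℝ) else 1)| ≤ (5 * γ + ε) / θ * u / (1 - θ)) ∧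
      (∀ u : ℝ, 0 < u → u ≤ γ → |betaInf S.β (fun _ : ℕ => u) - 1| ≤ (5 * γ + ε) / θ * u / (1 - θ)) ∧
      (∀ k : ℕ, (0 : ℝ) ≤ if k = 1 then (0 : ℝ) else 1) ∧ (0 : ℝ) < 1 ∧ ¬ Theorem2Statement S hL := by
  have hC : (γ + ε) * (1 - θ) ≤ (5 * γ + ε) / θ := by
    rw [le_div_iff₀ hθ0]
    nlinarith [mul_nonneg hγ0.le hθ0.le, mul_nonneg hε.le hθ0.le, hθ1.le, mul_nonneg (mul_nonneg hγ0.le hθ0.le) hθ0.le,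
      mul_nonneg (mul_nonneg hε.le hθ0.le) hθ0.le]
  refine ⟨histLipschitz_tilted hβ hε.le hγ0.le, fadingMemory_tilted hε.le hγ0.le hθ0 hθ1.le, scaleShiftRate_tilted hβ hε.le hε1 hγ hθ0 hθ1.le,
    fun k u hu huγ => zeroHist_tilted hβ hε.le hθ1 hγ0 hC k u hu huγ, fun u hu huγ => hb_tilted hβ (by positivity) hθ1 u hu huγ,
    fun k => by split_ifs <;> norm_num, one_pos, not_theorem2_tilted hβ hε hrg⟩

/-- **THE TYPED READING OF (0.31) IS NOT AN OPEN CONDITION.**  For EVERY tilt `0 < ε ≤ 1` the tilted family is `εδ`-close to part 8a's ramp `βr` on every box ]0, δ]^{k+1}, carries all the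
letters (§1), and refutes Theorem 2 AS TYPED for every setting carrying it under `hrg` — while the ramp carries Theorem 2 as typed for every setting with the printed `Definitions` and standing
hypotheses (`theorem2_typed_ramp`).  Contrast part 14c `uniformTheorem2_isOpen`: the g-uniform (0.31) has the margin `⨅_k b⁰_k` — here `= b⁰_1 = 0`. [folklore] -/
theorem typedTheorem2_not_open (hε : 0 < ε) {βr : HBeta}
    (hβr : ∀ (k : ℕ) (p : Fin (k + 1) → ℝ), βr k p = if k = 1 then p (Fin.last k) * (2 * p (Fin.last k) - p 0) else 1)
    {hL : Odd S.L ∧ 1 < S.L} (hrg : ∀ P : B12.RunParams, Step.InInterval (1 / 2) P.K (S.cpl P) → RGEqH P.K S.β (S.cpl P)) :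
    (∀ (δ : ℝ) (k : ℕ) (v : Fin (k + 1) → ℝ), v ∈ Box δ k → |βr k v - S.β k v| ≤ ε * δ) ∧ ¬ Theorem2Statement S hL :=
  ⟨fun _ k _ hv => abs_ramp_sub_tilted_le hβ hε.le hβr k hv, not_theorem2_tilted hβ hε hrg⟩

end Family

end

end Summit.QuantumFields.BalabanUV.Beta.EriceFlowEnclosureB12AsPrintedPointwiseFadingZeroHistoryConstantsWitness
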